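import Summits.ResolutionOfSingularities.ResolutionOfSingularities.Theorems.FrobeniusClosingSteerCompositeRankBelowModels

/-!
# Steer core, composite rank in EVERY dimension, part 2/2: rank `≥ 2` is side debt on resolution below the transcendence degree

OURS (campaign res-hironaka, rung L, slot W4.1, crux `Steer` stmt-ResolutionOfSingularities-16345, line
`switching_dichotomy` / res-L0-w41-strat-1's `ss-monomial-cycles` §F, stub S0 `CompositeRankSS`; prover seat res-type-028
gen 8; replaces the role of no printed item; NOT a statement of the manuscript under review; AI-produced, weaker than expert
review). `--supports stmt-ResolutionOfSingularities-16345 --as helper`. Hypothesis `hQE` as in part 1/2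
(`…CompositeRankBelowModels.lean`): resolution of reduced separated Noetherian quasi-excellent schemes of dimension `≤ d`.

This part:
* `dims_of_separating_affineModel` — for a model of dimension `≤ d + 1` separating `O < O₁`, both local dimensions are `≤ d`
  (twin of `dims_of_separating_affineModel4`);
* `exists_affineModel_regular_of_lt_of_qeRes` — regular models for composite valuations at `trdeg_k K ≤ d + 1`
  (twin of `exists_affineModel_regular_of_lt_of_cp2019`, through the tree-PROVED `novacoskiSpivakovsky2014_cor214 / _cor217 /
  _step`);
* `concl_of_hasProperCoarsening_of_qeRes` — the crux-facing form: at `trdeg_k K ≤ d + 1`, along a valuation ring WITH a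
  proper coarsening, `Concl O A₀ t` holds for EVERY datum `t ^ p ∈ A₀ ⊆ O` (`A₀` finitely generated, `Frac A₀[t] = K`),
  given `hQE` at `d` — no torsor structure, no strong switching, no zero-dimensionality is used. This is the kernel of
  stub S0 `CompositeRankSS` under the binder «quasi-excellent resolution below `n`» (res-L0-w41-tri-1 SECOND READ, fix (a)):
  `n ≥ 5 ↦ d = n − 1`; at `n = 4` it re-proves p493665 from `CossartPiltant2019General`
  (`concl_of_hasProperCoarsening_of_cp2019'`, the one-line comparison).
No definitions.
-/


noncomputable section

-- single-problem summit: the doubled namespace component `ResolutionOfSingularities` is forced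
set_option linter.dupNamespace false

open scoped BigOperators Classical

namespace Summit.ResolutionOfSingularities.ResolutionOfSingularities.Theorems.SteerRankThinness

section CompositeBelow

open IsLocalRing Algebra
open Literature.AlgebraicGeometry.Resolution
open CategoryTheory AlgebraicGeometry

universe u

variable {k K : Type u} [Field k] [Field K] [Algebra k K]

/-- **The two dimensions are `≤ d`** (PROVED; the `4 ↦ d + 1` twin of `dims_of_separating_affineModel4`, same
proof): for a finitely generated model `A ⊆ O ≤ O₁ < K` of dimension `≤ d + 1` containing `x ∈ 𝔪_O ∖ 𝔪_{O₁}`, with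
`Q ⊇ P` the centres of `O ⊇ O₁` on `A`: `P ≤ Q`, `dim A_P ≤ d` and `ht (Q/P) ≤ d` — since `0 < ht P < ht Q ≤ d + 1` and
`ht P + ht (Q/P) ≤ ht Q`. [folklore] -/
theorem dims_of_separating_affineModel {d : ℕ} (O O₁ : ValuationSubring K) (hO : O ≤ O₁) (hO₁ : O₁ ≠ ⊤)
    (A : Subalgebra k K) (hAfg : A.FG) [IsFractionRing A K] (hA : A.toSubring ≤ O.toSubring)
    (hdimA : ringKrullDim A ≤ (d + 1 : ℕ))
    (x : K) (hxA : x ∈ A) (hxO : O.valuation x < 1) (hxO₁ : O₁.valuation x = 1)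
    (Q P : Ideal A) [Q.IsPrime] [P.IsPrime]
    (hQ : ∀ z : A, z ∈ Q ↔ O.valuation (z : K) < 1)
    (hP : ∀ z : A, z ∈ P ↔ O₁.valuation (z : K) < 1) :
    P ≤ Q ∧ ringKrullDim (Localization.AtPrime P) ≤ d ∧
      (Q.map (Ideal.Quotient.mk P)).height ≤ d := by
  classical
  haveI : IsNoetherianRing A := isNoetherianRing_of_fg hAfg
  have hAO : ∀ z : A, (z : K) ∈ O := fun z => hA z.2
  -- `P ≤ Q`, `P ≠ Q`
  have hPQ : P ≤ Q := by
    intro z hz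
    rw [hP] at hz
    rw [hQ]
    by_contra hnot
    have hz0 : (z : K) ≠ 0 := fun h0 => hnot (by rw [h0, map_zero]; exact zero_lt_one)
    have hz1 : O.valuation (z : K) = 1 :=
      le_antisymm ((O.valuation_le_one_iff _).mpr (hAO z)) (not_lt.mp hnot)
    have hzinv : (z : K)⁻¹ ∈ O := by rw [← O.valuation_le_one_iff, map_inv₀, hz1, inv_one]
    have h1 : O₁.valuation ((z : K)⁻¹) ≤ 1 := (O₁.valuation_le_one_iff _).mpr (hO hzinv)
    have h2 : O₁.valuation ((z : K) * (z : K)⁻¹) < 1 := by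
      rw [map_mul]
      calc O₁.valuation (z : K) * O₁.valuation ((z : K)⁻¹)
          ≤ O₁.valuation (z : K) * 1 := by gcongr
        _ = O₁.valuation (z : K) := mul_one _
        _ < 1 := hz
    rw [mul_inv_cancel₀ hz0, map_one] at h2
    exact lt_irrefl _ h2
  have hxQ : (⟨x, hxA⟩ : A) ∈ Q := (hQ _).mpr hxO
  have hxP : (⟨x, hxA⟩ : A) ∉ P := fun h => by
    have := (hP _).mp h
    rw [hxO₁] at this
    exact lt_irrefl _ this
  have hlt : P < Q := lt_of_le_of_ne hPQ fun h => hxP (h ▸ hxQ)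
  -- `P ≠ 0`
  have hPbot : (⊥ : Ideal A) < P := by
    rw [bot_lt_iff_ne_bot]
    intro hP0
    apply hO₁
    ext z
    simp only [ValuationSubring.mem_top, iff_true]
    obtain ⟨a, b, hb, rfl⟩ := IsFractionRing.div_surjective (A := A) z
    have hb0 : b ≠ 0 := nonZeroDivisors.ne_zero hb
    have hbP : b ∉ P := by rw [hP0]; exact hb0
    have hb1 : O₁.valuation (b : K) = 1 :=
      le_antisymm ((O₁.valuation_le_one_iff _).mpr (hO (hAO b)))
        (not_lt.mp fun hlt' => hbP ((hP b).mpr hlt'))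
    change (a : K) / (b : K) ∈ O₁
    rw [div_eq_mul_inv]
    refine mul_mem (hO (hAO a)) ?_
    rw [← O₁.valuation_le_one_iff, map_inv₀, hb1, inv_one]
  -- heights
  haveI hQ' : (Q.map (Ideal.Quotient.mk P)).IsPrime :=
    Ideal.map_isPrime_of_surjective Ideal.Quotient.mk_surjective (by rwa [Ideal.mk_ker])
  obtain ⟨a, ha⟩ := ENat.ne_top_iff_exists.mp (Ideal.height_ne_top_of_isPrime (I := P))
  obtain ⟨b, hb⟩ := ENat.ne_top_iff_exists.mp (Ideal.height_ne_top_of_isPrime (I := Q))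
  obtain ⟨c, hc⟩ := ENat.ne_top_iff_exists.mp
    (Ideal.height_ne_top_of_isPrime (I := Q.map (Ideal.Quotient.mk P)))
  have h01 : (⊥ : Ideal A).height < P.height := Ideal.height_strict_mono_of_isPrime hPbot
  have h12 : P.height < Q.height := Ideal.height_strict_mono_of_isPrime hlt
  have h3 : Q.height ≤ (d + 1 : ℕ) := by
    have h := (Ideal.height_le_ringKrullDim_of_isPrime (I := Q)).trans hdimA
    exact WithBot.coe_le_coe.mp h
  have hsum := add_le_height_of_le P Q hPQ a c ha.le hc.le
  rw [Ideal.height_bot, ← ha] at h01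
  rw [← ha, ← hb] at h12
  rw [← hb] at h3 hsum
  have h01' : 0 < a := by exact_mod_cast h01
  have h12' : a < b := by exact_mod_cast h12
  have h3' : b ≤ d + 1 := by exact_mod_cast h3
  have hsum' : a + c ≤ b := by exact_mod_cast hsum
  refine ⟨hPQ, ?_, ?_⟩
  · rw [IsLocalization.AtPrime.ringKrullDim_eq_height P (Localization.AtPrime P), ← ha]
    exact WithBot.coe_le_coe.mpr (by exact_mod_cast (by omega : a ≤ d))
  · rw [← hc]
    exact_mod_cast (by omega : c ≤ d)

/-- **Regular models for composite valuations in transcendence degree `≤ d + 1`** (PROVED; the `4 ↦ d + 1` twin of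
`exists_affineModel_regular_of_lt_of_cp2019`, same proof): `K/k` of `trdeg ≤ d + 1`, `O < O₁ < K` valuation rings
containing `k`, `R ⊆ O` a finitely generated model with `Frac R = K`. Then, given resolution of quasi-excellent schemes of
dimension `≤ d`, some finitely generated `A ⊇ R` inside `O` is regular at the centre of `O`: adjoin `x ∈ 𝔪_O ∖ 𝔪_{O₁}`;
`dims_of_separating_affineModel` bounds the two local dimensions by `d`; `model_regular_of_qeRes` uniformizes `ν₁`
(Cor. 2.14), `residueModel_regular_of_qeRes` uniformizes `ν₂` above the residue model (Cor. 2.17), and the blowing up of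
§3.1 (`novacoskiSpivakovsky2014_step`) concludes. [cite: NovacoskiSpivakovsky2014, §3.1] -/
theorem exists_affineModel_regular_of_lt_of_qeRes {d : ℕ}
    (hQE : ∀ (X : Scheme.{u}) [X.IsSeparated] [IsNoetherian X] [IsReduced X],
      Scheme.IsQuasiExcellent X → topologicalKrullDim X ≤ d → Scheme.HasResolution X)
    (hd : Algebra.trdeg k K ≤ (d + 1 : ℕ))
    (O O₁ : ValuationSubring K) (hO : O ≤ O₁) (hne : O ≠ O₁) (hO₁ : O₁ ≠ ⊤)
    (hk : ∀ c : k, algebraMap k K c ∈ O)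
    (R : Subalgebra k K) (hRfg : R.FG) [hRfrac : IsFractionRing R K]
    (hRO : R.toSubring ≤ O.toSubring) :
    ∃ (A : Subalgebra k K) (hA : A.toSubring ≤ O.toSubring), R ≤ A ∧ A.FG ∧
      IsRegularLocalRing (Localization.AtPrime ((maximalIdeal O).comap (Subring.inclusion hA))) := by
  classical
  have hexc : IsExcellentRing k := isExcellentRing_of_field k
  -- an element `x ∈ 𝔪_O ∖ 𝔪_{O₁}`
  obtain ⟨y, hyO₁, hyO⟩ : ∃ y : K, y ∈ O₁ ∧ y ∉ O := by
    by_contra h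
    push Not at h
    exact hne (le_antisymm hO fun z hz => h z hz)
  have hy0 : y ≠ 0 := fun h0 => hyO (by rw [h0]; exact O.zero_mem)
  set x : K := y⁻¹ with hxdef
  have hx0 : x ≠ 0 := inv_ne_zero hy0
  have hxO : x ∈ O := (O.mem_or_inv_mem y).resolve_left hyO
  have hxv : O.valuation x < 1 := by
    change O.valuation ((⟨x, hxO⟩ : O) : K) < 1
    rw [← ValuationSubring.valuation_lt_one_iff, mem_maximalIdeal, mem_nonunits_iff]
    intro hu
    apply hyO
    have := inv_mem_of_isUnit O hxO hu
    rwa [hxdef, inv_inv] at this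
  have hxv₁ : O₁.valuation x = 1 := by
    apply le_antisymm ((O₁.valuation_le_one_iff x).mpr (hO hxO))
    have h := (O₁.valuation_le_one_iff x⁻¹).mpr (by rw [hxdef, inv_inv]; exact hyO₁)
    rwa [map_inv₀, inv_le_one₀ ((Valuation.pos_iff _).mpr hx0)] at h
  -- the model `R' = R[x]`
  let R' : Subalgebra k K := R ⊔ Algebra.adjoin k {x}
  have hRR' : R ≤ R' := le_sup_left
  have hR'fg : R'.FG := hRfg.sup ⟨{x}, by rw [Finset.coe_singleton]⟩
  have hR'O : R'.toSubring ≤ O.toSubring := by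
    have : R' ≤ ({ O.toSubring with algebraMap_mem' := hk } : Subalgebra k K) :=
      sup_le (fun z hz => hRO hz) (Algebra.adjoin_le (Set.singleton_subset_iff.mpr hxO))
    exact fun z hz => this hz
  have hR'O₁ : R'.toSubring ≤ O₁.toSubring := hR'O.trans hO
  haveI hR'frac' : IsFractionRing R' K := isFractionRing_subalgebra_of_le R R' hRR'
  haveI hR'frac : IsFractionRing R'.toSubring K := hR'frac'
  have hxR' : x ∈ R' :=
    (le_sup_right : Algebra.adjoin k {x} ≤ R') (Algebra.subset_adjoin (Set.mem_singleton x))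
  haveI : IsNoetherianRing R' := isNoetherianRing_of_fg hR'fg
  haveI : Algebra.FiniteType k R' := (Subalgebra.fg_iff_finiteType _).mp hR'fg
  have hdimR' : ringKrullDim R' ≤ (d + 1 : ℕ) :=
    ringKrullDim_le_of_fg_of_trdeg_le R' hR'fg (d := d + 1) hd
  -- the centres on `R'`
  let Q : Ideal R' := (maximalIdeal O).comap (Subring.inclusion hR'O)
  let P : Ideal R' := (maximalIdeal O₁).comap (Subring.inclusion hR'O₁)
  haveI : Q.IsPrime := Ideal.IsPrime.comap _
  haveI : P.IsPrime := Ideal.IsPrime.comap _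
  have hQ : ∀ z : R', z ∈ Q ↔ O.valuation (z : K) < 1 := fun z => by
    rw [Ideal.mem_comap, ValuationSubring.valuation_lt_one_iff]; rfl
  have hP : ∀ z : R', z ∈ P ↔ O₁.valuation (z : K) < 1 := fun z => by
    rw [Ideal.mem_comap, ValuationSubring.valuation_lt_one_iff]; rfl
  obtain ⟨-, hdimP, -⟩ := dims_of_separating_affineModel O O₁ hO hO₁ R' hR'fg hR'O hdimR'
    x hxR' hxv hxv₁ Q P hQ hP
  have hexcP : IsExcellentRing (Localization.AtPrime P) := isExcellentRing_localization_atPrime hexc P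
  -- Cor. 2.14: a model regular at the centre of `ν₁`
  have h₁ := model_regular_of_qeRes hQE O₁ R' hR'fg hR'O₁ P hP hexcP hdimP
  obtain ⟨A, hA, hR'A, hAfg, hregPA⟩ :=
    novacoskiSpivakovsky2014_cor214 O O₁ hO R' hR'fg hR'frac' hR'O h₁
  -- Cor. 2.17 on `A`
  haveI hAfrac' : IsFractionRing A K := isFractionRing_subalgebra_of_le R' A hR'A
  haveI hAfrac : IsFractionRing A.toSubring K := hAfrac'
  have hAO₁ : A.toSubring ≤ O₁.toSubring := hA.trans hO
  have hdimA : ringKrullDim A ≤ (d + 1 : ℕ) :=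
    ringKrullDim_le_of_fg_of_trdeg_le A hAfg (d := d + 1) hd
  let QA : Ideal A := (maximalIdeal O).comap (Subring.inclusion hA)
  let PA : Ideal A := (maximalIdeal O₁).comap (Subring.inclusion hAO₁)
  haveI : QA.IsPrime := Ideal.IsPrime.comap _
  haveI : PA.IsPrime := Ideal.IsPrime.comap _
  have hQA : ∀ z : A, z ∈ QA ↔ O.valuation (z : K) < 1 := fun z => by
    rw [Ideal.mem_comap, ValuationSubring.valuation_lt_one_iff]; rfl
  have hPA : ∀ z : A, z ∈ PA ↔ O₁.valuation (z : K) < 1 := fun z => by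
    rw [Ideal.mem_comap, ValuationSubring.valuation_lt_one_iff]; rfl
  obtain ⟨hPQA, -, hdimQPA⟩ := dims_of_separating_affineModel O O₁ hO hO₁ A hAfg hA hdimA
    x (hR'A hxR') hxv hxv₁ QA PA hQA hPA
  have h₂ := residueModel_regular_of_qeRes hQE O O₁ hO A hA hAfg QA PA hQA hPA hPQA hdimQPA
  obtain ⟨A₂, hA₂, hAA₂, hA₂fg, hregP₂, hregQ₂⟩ :=
    novacoskiSpivakovsky2014_cor217 O O₁ hO A hA hAfg hAfrac' hregPA h₂
  -- §3.1, final step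
  haveI hA₂frac : IsFractionRing A₂.toSubring K :=
    isFractionRing_subalgebra_of_le A A₂ hAA₂
  obtain ⟨A₃, hA₃, hA₂₃, hA₃fg, hreg₃⟩ :=
    novacoskiSpivakovsky2014_step O O₁ hO A₂ hA₂ hA₂fg hA₂frac hregP₂ hregQ₂
  exact ⟨A₃, hA₃, hRR'.trans (hR'A.trans (hAA₂.trans hA₂₃)), hA₃fg, hreg₃⟩

/-- **Crux-facing form, every dimension** (PROVED; the `4 ↦ d + 1` twin of `concl_of_hasProperCoarsening`): at
`trdeg_k K ≤ d + 1`, along a valuation ring WITH a proper coarsening, and given resolution of reduced separated Noetherian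
quasi-excellent schemes of dimension `≤ d`, the conclusion `Concl O A₀ t` of the frontier stubs of line
`switching_dichotomy` holds for EVERY datum `t ^ p ∈ A₀` (`A₀ ⊆ O` finitely generated, `Frac A₀[t] = K`) — no torsor
structure, no strong switching, no regularity, no zero-dimensionality is used. This is the kernel of stub S0
`CompositeRankSS` of res-L0-w41-strat-1's line `ss-monomial-cycles` under the binder «quasi-excellent resolution below the
transcendence degree» (`n ↦ d + 1`). [cite: NovacoskiSpivakovsky2014, §3.1] -/
theorem concl_of_hasProperCoarsening_of_qeRes {d : ℕ}
    (hQE : ∀ (X : Scheme.{u}) [X.IsSeparated] [IsNoetherian X] [IsReduced X],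
      Scheme.IsQuasiExcellent X → topologicalKrullDim X ≤ d → Scheme.HasResolution X)
    (p : ℕ) (hp : p ≠ 0)
    (hd : Algebra.trdeg k K ≤ (d + 1 : ℕ)) (O : ValuationSubring K) (hO : HasProperCoarsening O)
    (A₀ : Subalgebra k K) (h₀ : A₀.toSubring ≤ O.toSubring) (t : K) (hA₀ : A₀.FG) (htp : t ^ p ∈ A₀)
    (hfrac : IsFractionRing (Algebra.adjoin k (insert t (A₀ : Set K))) K) : Concl O A₀ t := by
  classical
  obtain ⟨O₁, hOO₁, hne, hO₁⟩ := hO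
  have hk : ∀ c : k, algebraMap k K c ∈ O := fun c => h₀ (A₀.algebraMap_mem c)
  have htO : t ∈ O := by
    have h1 : O.valuation (t ^ p) ≤ 1 := (O.valuation_le_one_iff _).mpr (h₀ htp)
    rw [map_pow] at h1
    exact (O.valuation_le_one_iff t).mp ((pow_le_one_iff_of_nonneg zero_le hp).mp h1)
  have hA₀R : A₀ ≤ Algebra.adjoin k (insert t (A₀ : Set K)) := fun z hz =>
    Algebra.subset_adjoin (Set.mem_insert_of_mem t hz)
  have htR : t ∈ Algebra.adjoin k (insert t (A₀ : Set K)) := Algebra.subset_adjoin (Set.mem_insert t _)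
  have hRfg : (Algebra.adjoin k (insert t (A₀ : Set K))).FG := by
    obtain ⟨s, hs⟩ := hA₀
    refine ⟨insert t s, ?_⟩
    rw [← hs, Finset.coe_insert, Algebra.adjoin_insert_adjoin]
  have hRO : (Algebra.adjoin k (insert t (A₀ : Set K))).toSubring ≤ O.toSubring := by
    have : Algebra.adjoin k (insert t (A₀ : Set K)) ≤
        ({ O.toSubring with algebraMap_mem' := hk } : Subalgebra k K) :=
      Algebra.adjoin_le (Set.insert_subset_iff.mpr ⟨htO, fun z hz => h₀ hz⟩)
    exact fun z hz => this hz
  haveI : IsFractionRing (Algebra.adjoin k (insert t (A₀ : Set K))) K := hfrac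
  obtain ⟨A, hA, hRA, hAfg, hreg⟩ := exists_affineModel_regular_of_lt_of_qeRes hQE hd O O₁ hOO₁ hne hO₁ hk
    (Algebra.adjoin k (insert t (A₀ : Set K))) hRfg hRO
  exact ⟨A, hA, hA₀R.trans hRA, hRA htR, hAfg,
    isFractionRing_subalgebra_of_le (Algebra.adjoin k (insert t (A₀ : Set K))) A hRA, hreg⟩

/-- One-line COMPARISON with the landed `n = 4` file (PROVED): `CossartPiltant2019General` supplies the hypothesis `hQE`
at `d = 3` (its isomorphism-over-`Reg` clause is dropped), so `concl_of_hasProperCoarsening_of_qeRes` at `d = 3`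
re-proves `concl_of_hasProperCoarsening` (p493665). [cite: CossartPiltant2019, Thm. 1.1] -/
theorem concl_of_hasProperCoarsening_of_cp2019' (hCP : CossartPiltant2019General.{u}) (p : ℕ) (hp : p ≠ 0)
    (h4 : Algebra.trdeg k K ≤ 4) (O : ValuationSubring K) (hO : HasProperCoarsening O)
    (A₀ : Subalgebra k K) (h₀ : A₀.toSubring ≤ O.toSubring) (t : K) (hA₀ : A₀.FG) (htp : t ^ p ∈ A₀)
    (hfrac : IsFractionRing (Algebra.adjoin k (insert t (A₀ : Set K))) K) : Concl O A₀ t :=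
  concl_of_hasProperCoarsening_of_qeRes (d := 3)
    (fun X _ _ _ hqe hdim => by
      obtain ⟨X', π, hπ, -⟩ := hCP X hqe hdim
      exact ⟨X', π, hπ⟩)
    p hp (by exact_mod_cast h4) O hO A₀ h₀ t hA₀ htp hfrac

end CompositeBelow

end Summit.ResolutionOfSingularities.ResolutionOfSingularities.Theorems.SteerRankThinness

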